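import Summits.QuantumAdvantage.QuantumAdvantage.Theorems.CubicForrelationNearExactIsExactTwelveLevelSixRigidPack

/-!
# Crux `CubicForrelation.NearExactIsExact` (stmt-QuantumAdvantage-14043) — n = 12, level ≥ 6 AT `Φ = 935/1024`: packaging the RIGID off-flat
  configurations at off-flat energy `≤ 200` (`≥ 48` points of cost `≥ 4`, at most `8` to spare)

Certificate seat `b2b-cforr-cert` (gen 18).  HONEST FRAMING: elementary bookkeeping (standard axioms) for the level-`≥ 6` branch of "is `935/1024`
attained at `n = 12`?"; NOT summit progress.

`tw18_rigid_pack200`: if `48` or more points off `Z`, each with `e² = 4` or `e² ≥ 16`, lie in three given cosets, every other point off `Z` has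
`e = 0` or `e² ≥ 16`, and the total off-flat energy is `≤ 200`, then those points have `e² = 4`, every other point off `Z` has `e = 0`, there are
at most `50` of them, and the set `Ω = {y ∉ Z : 8 ∤ e(y)}` is contained in them: `Ω` lies in the three cosets, `#Ω ≤ 50`, `e² = 4` on `Ω`, energy
`≥ 192`.  (Gen 18's `tw18_rigid_pack` is the case of energy `≤ 192`.)
-/

set_option linter.dupNamespace false -- D-0017: single-problem summit ⇒ `QuantumAdvantage.QuantumAdvantage` by design

noncomputable section

namespace Summit.QuantumAdvantage.QuantumAdvantage.Theorems.CubicForrelation.NearExactIsExact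

open Finset

/-- **Rigid packaging at off-flat energy `≤ 200`.**  See the module docstring. [this work] -/
theorem tw18_rigid_pack200 {α : Type*} [DecidableEq α] [Fintype α] (e : α → ℤ) (Z U C₁ C₂ C₃ : Finset α)
    (hUZ : ∀ x ∈ U, x ∉ Z) (hU4 : ∀ x ∈ U, e x ^ 2 = 4 ∨ 16 ≤ e x ^ 2) (hU48 : 48 ≤ #U) (hUC : ∀ x ∈ U, x ∈ C₁ ∨ x ∈ C₂ ∨ x ∈ C₃)
    (hout : ∀ x, x ∉ Z → x ∉ U → e x = 0 ∨ 16 ≤ e x ^ 2)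
    (hoff_le : ∑ x ∈ univ.filter (fun x => x ∉ Z), e x ^ 2 ≤ 200) :
    (∀ ω ∈ univ.filter (fun ω => ω ∉ Z ∧ ¬ (8 : ℤ) ∣ e ω), ω ∈ C₁ ∨ ω ∈ C₂ ∨ ω ∈ C₃) ∧
    #(univ.filter (fun ω => ω ∉ Z ∧ ¬ (8 : ℤ) ∣ e ω)) ≤ 50 ∧
    (∀ ω ∈ univ.filter (fun ω => ω ∉ Z ∧ ¬ (8 : ℤ) ∣ e ω), e ω ^ 2 = 4) ∧
    192 ≤ ∑ x ∈ univ.filter (fun x => x ∉ Z), e x ^ 2 := by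
  classical
  have hUsub : U ⊆ univ.filter (fun x => x ∉ Z) := fun x hx => mem_filter.2 ⟨mem_univ _, hUZ x hx⟩
  have hU4' : ∀ x ∈ U, 4 ≤ e x ^ 2 := fun x hx => by rcases hU4 x hx with h | h <;> linarith
  have hUsum_ge : 4 * (#U : ℤ) ≤ ∑ x ∈ U, e x ^ 2 := by
    have h := sum_le_sum hU4'
    rw [sum_const, nsmul_eq_mul] at h
    linarith
  have hsplit := sum_filter_add_sum_filter_not (univ.filter fun x => x ∉ Z) (fun x => x ∈ U) (fun x => e x ^ 2)
  have e1 : (univ.filter fun x : α => x ∉ Z).filter (fun x => x ∈ U) = U := by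
    ext y; simp only [mem_filter, mem_univ, true_and]; exact ⟨fun h => h.2, fun h => ⟨hUZ y h, h⟩⟩
  rw [e1] at hsplit
  have hrest_nn : 0 ≤ ∑ x ∈ (univ.filter fun x : α => x ∉ Z).filter (fun x => x ∉ U), e x ^ 2 :=
    sum_nonneg fun y _ => sq_nonneg (e y)
  have hU48' : (48 : ℤ) ≤ #U := by exact_mod_cast hU48
  have hUle : ∑ x ∈ U, e x ^ 2 ≤ 200 := by linarith
  have hUcard : #U ≤ 50 := by
    have : (#U : ℤ) ≤ 50 := by linarith
    exact_mod_cast this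
  have hrest8 : ∑ x ∈ (univ.filter fun x : α => x ∉ Z).filter (fun x => x ∉ U), e x ^ 2 ≤ 8 := by linarith
  -- `e = 0` off `Z ∪ U`
  have hrest : ∀ x, x ∉ Z → x ∉ U → e x = 0 := by
    intro x hxZ hxU
    rcases hout x hxZ hxU with h0 | h16
    · exact h0
    · exfalso
      have hx : x ∈ (univ.filter fun x : α => x ∉ Z).filter (fun x => x ∉ U) :=
        mem_filter.2 ⟨mem_filter.2 ⟨mem_univ _, hxZ⟩, hxU⟩
      have := single_le_sum (f := fun y => e y ^ 2) (fun y _ => sq_nonneg (e y)) hx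
      linarith
  -- `e² = 4` on `U`
  have hU4eq : ∀ x ∈ U, e x ^ 2 = 4 := by
    have hz : ∑ x ∈ U, (e x ^ 2 - 4) ≤ 8 := by
      rw [sum_sub_distrib, sum_const, nsmul_eq_mul]
      linarith
    intro x hx
    rcases hU4 x hx with h | h
    · exact h
    · exfalso
      have h1 : e x ^ 2 - 4 ≤ ∑ y ∈ U, (e y ^ 2 - 4) :=
        single_le_sum (f := fun y => e y ^ 2 - 4) (fun y hy => by linarith [hU4' y hy]) hx
      linarith
  have hΩU : ∀ ω ∈ univ.filter (fun ω => ω ∉ Z ∧ ¬ (8 : ℤ) ∣ e ω), ω ∈ U := by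
    intro ω hω
    obtain ⟨hωZ, hω8⟩ := (mem_filter.1 hω).2
    by_contra hωU
    exact hω8 (by rw [hrest ω hωZ hωU]; exact dvd_zero _)
  refine ⟨fun ω hω => hUC ω (hΩU ω hω), (card_le_card fun ω hω => hΩU ω hω).trans hUcard, fun ω hω => hU4eq ω (hΩU ω hω), ?_⟩
  have hUle' : ∑ x ∈ U, e x ^ 2 ≤ ∑ x ∈ univ.filter (fun x => x ∉ Z), e x ^ 2 :=
    sum_le_sum_of_subset_of_nonneg hUsub fun x _ _ => sq_nonneg _
  linarith

end Summit.QuantumAdvantage.QuantumAdvantage.Theorems.CubicForrelation.NearExactIsExact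

end
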